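import Literature.MathematicalPhysics.QuantumFieldTheory.Balaban1983to89.B9Eq326G1kSupRowClosed
import Literature.MathematicalPhysics.QuantumFieldTheory.Balaban1983to89.B9Eq342GreenPrimeTowerDecayRowClosed
import Literature.MathematicalPhysics.QuantumFieldTheory.Balaban1983to89.B9Eq3126H1SupRowOfLetters

import Literature.MathematicalPhysics.QuantumFieldTheory.Balaban1983to89.B9Eq33CovDerivLocalLetterTower

/-!
# `Balaban1983to89.B9Eq3152RkWordSupGradLettersClosed` — T. Bałaban, *Propagators for lattice gauge theories in a background field*, Commun. Math. Phys. **99** (1985)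
# 389–434 [Balaban1985BackgroundPropagators] (3.25) p. 394 (*«Rf = (I − G′Q′\*(Q′G′²Q′\*)⁻¹Q′G′)f»*), Thm 3.1 (3.42) p. 397, (3.19) p. 393, Thm 3.11 p. 416, (3.152) p. 426:
# **THE VALUE LETTER AND THE COVARIANT-GRADIENT LETTER OF THE (3.25)-WORD `X_k = G′_kQ̃′_k†(Q̃′_kG′_k²Q̃′_k†)⁻¹Q̃′_kG′_k` ON PRINT's DIAGONAL, `∃ (α_x, B_x, κ_x)` FIRST,
# UNCONDITIONAL on the cell's MODEL letters** — for a site field `w` supported over `Π⁻¹(v)` with `‖w‖_∞ ≤ F`: `‖(X_kw)(x)‖ ≤ B_x·e^{−κ_x d_m(Πx,v)}·F` and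
# `‖(D_U(X_kw))(b)‖ ≤ B_x·e^{−κ_x d_m(Π(b₋),v)}·F` — the hypothesis (HX) of this lineage's HJ-5 `B9Eq3152RkStepHolderLetterDocking`, i.e. the sup-currency half of the
# `R_k`-step of STOREY H; ne9-leaf-03 g80's `B9Eq3152ProjGreenPrimeGradRowClosed` (p400xxx ✓) with the trailing `G′_k` dropped and the leading letter read twice
# ((DRC) for the value, (GRC) for the gradient, re-blocked tip → base); NE9 crux-team LEAF PROVER 01, gen 92

statement-level skeleton of published theorems with citation tags; proofs where landed; nothing here is a claim about the Yang–Mills mass gap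

CITATION HEADER (lean-in-tree rule).  Audit cell `pub-balaban`, sub-cell `t4`, BINDER row NE9; filed by NE9 crux-team LEAF PROVER 01 (`b2b-balaban-t4-ne9-formalise-leaf-01`,
gen 92; bears_on: R4/N22).  THIS FILE IS ne9-leaf-03 g80's `B9Eq3152ProjGreenPrimeGradRowClosed` RE-RUN FOR THE WORD `X_k` — same imports (+ `B9Eq33CovDerivLocalLetterTower` for
the tip → base re-blocking), same suppliers, same binder block, same letters; credit for the engine is (K70)'s (ne9-leaf-05 g87) and leaf-03 g80's.  Suppliers BY NAME: the
NE9 owner's (GRC) `B9Eq342GreenPrimeTowerGradientRowClosed.exists_gradRow_GpOfUk` (`D_UG′_k`), (DRC) `B9Eq342GreenPrimeTowerDecayRowClosed.exists_decayRow_GpOfUk` (`G′_k`,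
twice), ne9-leaf-05's (K64a) `B9Eq326WoodburyLettersTower.exists_local_letter_QGGQInvk_closed` (`c_k = (Q̃′_kG′_k²Q̃′_k†)⁻¹`, constructed at the unitary background as
`greenK _ (B9Eq325ProjFormulaTower.QGGQk_pos_of_unitary …)` — the term of `RofUk_eq_formula_of_unitary`), `B9Eq324PenaltyPointwiseBound.norm_QtildeTower_le` ∕
`norm_adjoint_QtildeTower_apply_le`, `B9Eq324PenaltyBlockLocal.QprimeTowerW_apply_eq_of_eqOn_fibre` ∕ `adjoint_QtildeTower_apply_eq_of_eq_at`,
`B9Eq342GreenPrimeTowerSupBoundDecay.bigBlock_eq_iff`, `B9Eq347LocalFromBlockDecay.norm_le_sqrt_mass_mul`, ne9-leaf-01's `B9Eq349BlockMultipliers.exists_block_clm_family`,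
(K63) `B9Eq3126H1SupRowOfLetters.letter_of_range`, `B9Eq342TowerBigBlocks.card_sites_bigBlock_le`, `B4Sect5Torus.torusSum_le`, (K61) `B9Eq326G1SupRowOfLetters.letter_comp`,
`B9Eq33CovDerivLocalLetterTower.tdist_bigBlock_bpos_btgt_le_one`.  Source READ first-hand this generation (`paper:balaban1985-cmp99-background-propagators`, journal page = PDF page
+ 388): p. 394 (3.25), pp. 397–398 Thm 3.1, p. 426 (3.152)–(3.153).  NOTHING of print's proof is reproduced; no constant of print is valued.

WHAT IS PROVED (sorry-free; proof lane — no `def`; [folklore] composition BY NAME).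
* **`exists_local_letters_RkWord`** — `∃ α_x B_x κ_x > 0` BEFORE `∀ n η c₀ c₁ m U …` ((K70)'s data block verbatim — only `G′_k`'s `hpos′` enters): for every fine-site field
  `w` supported over the big block `Π⁻¹(v)` with `‖w(x)‖ ≤ F`: the VALUE letter `‖(X_kw)(x)‖ ≤ B_x·e^{−κ_x·d_m(Πx, v)}·F` AND the COVARIANT-GRADIENT letter
  `‖(D_U(X_kw))(b)‖ ≤ B_x·e^{−κ_x·d_m(Π(b₋), v)}·F` (output at the bond's BASE block; (GRC)'s tip-block row re-blocked at the price `e^{κ_x}`).  Four (K61) `letter_comp`;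
  `κ_x := κ∕2`, `κ := min(κ_D, κ_P, ρ_c)`, `B_x = B_P·K·B_c·K·K·(B_P + B_D·e^{κ∕2})·K`, `K = K_d(κ∕2)`.  One `set_option maxHeartbeats 800000` (two conclusions over the block
  + six suppliers: the defeq assembly of the word, not a search).
HONEST SCOPE.  ARCHITECTURE-INDEPENDENT (site-side objects `G′_k`, `Q̃′_k`, `c_k` only).  Constants crude; nothing of [B9] Thm 3.1∕3.11∕3.13 or (3.25) asserted, valued or
discharged; «NE9 ⇐ the named binders»; NE9 NOT PRINTED ∕ NOT PROVED; row WALLED ON A MODEL (O-NE9-1; #5 UNRULED); spine PROVED 0∕9; rung (B)+1 on a finite T⁴ — NOT infinite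
volume, NOT mass gap, NOT BetaPertH, NOT Clay.  HONEST DEPENDENCY: continuum YM on T⁴ ⇐ BetaPertH ∧ nine spine estimates (0/9 proved); BetaPertH ⇐ (D1) ∧ (D4) ∧ CAP+tail;
G-an2-4 gates asym, D1 and NE2/3/4.  NEW file importing BUILT modules; nothing modified.  Net new unproved facts: 0.
-/

noncomputable section

set_option autoImplicit false

open scoped InnerProductSpace ComplexConjugate BigOperators

namespace Literature.MathematicalPhysics.QuantumFieldTheory.Balaban1983to89.B9Eq3152RkWordSupGradLettersClosed

open B4Sect5Torus (TSite tdist tdist_nonneg tdist_symm tdist_self tdist_triangle torusSum_le)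
open B4Sect5Proof (latticeConst latticeConst_nonneg)
open B9SectCLatticeCarrier (Bond DirPair bpos btgt shift unshift)
open B9Eq311L2Pairing (WL2)
open B9Eq319QprimeTorus (fineP blockCoord)
open B7Prop1Explicit (U1 Wcx boxVec)
open B11Eq103H1Complex (SiteL2K BondL2K greenK covDerivL2K)
open B9Eq310DeltaPrime (plaqHolU)
open B9Eq310HessianOperator (adTransportW)
open B9Eq310HessianHermitian (adTransportW_adjoint)
open B9Eq315QTorus (perCfg cornerSite)
open B9Eq315QTower (towerP UlevOf)
open B9Eq316TowerFlatIsOneStep (towerP_eq_fineP_pow siteCast)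
open B9Eq326OperatorTower (QprimeTowerW RofUk)
open B9Eq324DeltaPrimeATower (laplacePrimeAk GpOfUk)
open B9Eq325ProjFormulaTower (QGGQk_pos QGGQk_pos_of_unitary RofUk_eq_formula)
open B9Eq349BlockMultipliers (exists_block_clm_family)
open B9Eq326WoodburyLettersTower (exists_local_letter_QGGQInvk_closed)
open B9Eq342GreenPrimeTowerGradientRowClosed (exists_gradRow_GpOfUk)
open B9Eq342GreenPrimeTowerDecayRowClosed (exists_decayRow_GpOfUk)
open B9Eq324PenaltyPointwiseBound (norm_QtildeTower_le norm_adjoint_QtildeTower_apply_le)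
open B9Eq324PenaltyBlockLocal (QprimeTowerW_apply_eq_of_eqOn_fibre adjoint_QtildeTower_apply_eq_of_eq_at)
open B9Eq342GreenPrimeTowerSupBoundDecay (bigBlock_eq_iff)
open B9Eq342TowerBigBlocks (card_sites_bigBlock_le)
open B9Eq33CovDerivLocalLetterTower (tdist_bigBlock_bpos_btgt_le_one)

open B9Eq347LocalFromBlockDecay (norm_le_sqrt_mass_mul)
open B9Eq326G1SupRowOfLetters (letter_comp)
open B9Eq3126H1SupRowOfLetters (letter_of_range)

variable {d : ℕ} (hd : 1 ≤ d) (L : ℕ) [NeZero L] (hL : 1 ≤ L) (hL3 : 3 ≤ L)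
  {𝔸 : Type*} [NormedRing 𝔸] [NormedAlgebra ℂ 𝔸] [CompleteSpace 𝔸] [NormOneClass 𝔸] [StarRing 𝔸] [NormedStarGroup 𝔸] [StarModule ℂ 𝔸]
  {W : Type*} [NormedAddCommGroup W] [InnerProductSpace ℂ W] [FiniteDimensional ℂ W] (φ : W ≃ₗ[ℂ] 𝔸)
  {Mφ Mφ' : ℝ} (hMφ : 0 ≤ Mφ) (hMφ' : 0 ≤ Mφ') (hφ : ∀ w, ‖φ w‖ ≤ Mφ * ‖w‖) (hφ' : ∀ X, ‖φ.symm X‖ ≤ Mφ' * ‖X‖) (hstar : ∀ X : 𝔸, ‖star X‖ ≤ ‖X‖)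
  {a : ℝ} (ha : 0 < a) {a' : ℝ} (ha' : 0 < a') {ϱ : ℝ} (hϱ0 : 0 ≤ ϱ) (hϱ1 : ϱ < 1)
  (τ : 𝔸 →ₗ[ℂ] ℂ) {Cτ : ℝ} (hτ : ∀ X, ‖τ X‖ ≤ Cτ * ‖X‖) (hCτ : 0 ≤ Cτ) {Mτ : ℝ} (hτm : ∀ X Y : 𝔸, ‖τ (X * Y)‖ ≤ Mτ * ‖X‖ * ‖Y‖) (hMτ : 0 ≤ Mτ)
  {ρw : ℝ} (hρw : 0 ≤ ρw)
  (hτ₁ : ∀ X : 𝔸, τ (star X) = conj (τ X)) (hτ₂ : ∀ X Y : 𝔸, τ (X * Y) = τ (Y * X)) (hφτ : ∀ X Y : 𝔸, ⟪φ.symm X, φ.symm Y⟫_ℂ = τ (star X * Y))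
  (AQ : ℝ)

omit [NeZero L] in
/-- `e^{−r t} ≤ e^{−κ t}` for `κ ≤ r`, `0 ≤ t`. [folklore] -/
private theorem exp_weaken' {r κ t : ℝ} (hκ : κ ≤ r) (ht : 0 ≤ t) : Real.exp (-(r * t)) ≤ Real.exp (-(κ * t)) :=
  Real.exp_le_exp.2 (by nlinarith)

set_option maxHeartbeats 800000 in -- two conclusions over the ≈ 40-binder block + six suppliers: the defeq assembly of the word exceeds the default budget
include hd hL hL3 hMφ hMφ' hφ hφ' ha ha' hϱ0 hϱ1 hτ hCτ hMτ hρw hτ₁ hτ₂ hφτ in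
/-- **THE VALUE LETTER AND THE COVARIANT-GRADIENT LETTER OF THE (3.25)-WORD `X_k = G′_kQ̃′_k†(Q̃′_kG′_k²Q̃′_k†)⁻¹Q̃′_kG′_k` ON PRINT's DIAGONAL, UNCONDITIONAL on the
cell's MODEL letters** — the hypothesis (HX) of this lineage's HJ-5 `B9Eq3152RkStepHolderLetterDocking`, literally: `∃ (α_x, B_x, κ_x)` first; for a site field `w`
supported over `Π⁻¹(v)` with `‖w‖_∞ ≤ F`: `‖(X_kw)(x)‖ ≤ B_x·e^{−κ_x·d_m(Πx, v)}·F` and `‖(D_U(X_kw))(b)‖ ≤ B_x·e^{−κ_x·d_m(Π(b₋), v)}·F`.  ne9-leaf-03 g80's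
`B9Eq3152ProjGreenPrimeGradRowClosed` with the trailing `G′_k` dropped and the leading letter read twice ((DRC) for the value, (GRC) for the gradient, re-blocked tip → base
by `tdist_bigBlock_bpos_btgt_le_one`): four (K61) `letter_comp`. [cite: Balaban1985BackgroundPropagators, (3.25) p.394, Thm 3.1 (3.42) p.397, (3.19) p.393, Thm 3.11 p.416,
(3.152) p.426] -/
theorem exists_local_letters_RkWord :
    ∃ αx Bx κx : ℝ, 0 < αx ∧ 0 ≤ Bx ∧ 0 < κx ∧
      ∀ (n : ℕ) (η : ℝ) (_hηL : η * (L : ℝ) ^ (n + 1) = 1) (c₀ c₁ : ℝ) [Fact (0 < c₀)] [Fact (0 < c₁)]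
        (_hw : c₀ * ((L : ℝ) ^ (n + 1)) ^ d = c₁) (_hρ : |η| ^ d / c₀ ≤ ρw) (m : Fin d → ℕ) [∀ i, NeZero (m i)] (_hm : ∀ i, 1 ≤ m i)
        (U : Bond d (towerP L m (n + 1)) → 𝔸ˣ) (αU : ℕ → ℝ) (_hα0 : ∀ j, 0 ≤ αU j) (hα1 : ∀ j, αU j ≤ 1 / 64)
        (hU1 : ∀ (j : ℕ) (x : B7Prop1Explicit.Site d) (k : Fin d), perCfg (towerP L m (j + 1)) (UlevOf L m (n + 1) U j) x k ∈ U1 𝔸)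
        (hreg : ∀ (j : ℕ) (y : TSite d (towerP L m j)) (k : Fin d) (ρ' : Fin d → Fin L),
          ‖((Wcx L (perCfg (towerP L m (j + 1)) (UlevOf L m (n + 1) U j)) (cornerSite L y) k (boxVec L ρ') : 𝔸ˣ) : 𝔸) - 1‖ ≤ αU j)
        (εU : ℕ → ℝ) (_hεU : ∀ j, 0 ≤ εU j) (_hUε : ∀ (j : ℕ) (b : Bond d (towerP L m (j + 1))), ‖(UlevOf L m (n + 1) U j b : 𝔸) - 1‖ ≤ εU j)
        (_hLb : ∀ (j : ℕ) (b : Bond d (towerP L m (j + 1))), UlevOf L m (n + 1) U j b ∈ U1 𝔸)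
        (α : ℝ) (_hα : 0 ≤ α) (_hαle : α ≤ αx)
        (hUst : ∀ b, star (U b : 𝔸) = (((U b)⁻¹ : 𝔸ˣ) : 𝔸)) (_hUb : ∀ b, U b ∈ U1 𝔸) (_hUη : ∀ b, ‖(U b : 𝔸) - 1‖ ≤ α * η)
        (_hpl : ∀ p : B9SectCLatticeCarrier.Plaq d (towerP L m (n + 1)), ‖(plaqHolU U p : 𝔸) - 1‖ ≤ α * η ^ 2)
        (_hUgrad : ∀ (x : TSite d (towerP L m (n + 1))) (μ : Fin d), ‖(U (x, μ) : 𝔸) - U (unshift μ x, μ)‖ ≤ α * η ^ 2)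
        (_hRlev : ∀ (j : ℕ) (b : Bond d (towerP L m (j + 1))) (w : W), ‖adTransportW φ (UlevOf L m (n + 1) U j) b w‖ ≤ ‖w‖)
        (_hεg : ∀ j < n + 1, εU j ≤ α * ϱ ^ j) (_hAQ : ∑ j ∈ Finset.range (n + 1), αU j ≤ AQ)
        (hpos' : ∀ x : SiteL2K ℂ d (towerP L m (n + 1)) c₀ W, x ≠ 0 → 0 < RCLike.re ⟪x, laplacePrimeAk L m n φ η U a' (c₁ := c₁) x⟫_ℂ)
        (v : TSite d m) (w : SiteL2K ℂ d (towerP L m (n + 1)) c₀ W) (F : ℝ)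
        (_hwv : ∀ x, blockCoord (L ^ (n + 1)) m (siteCast (towerP_eq_fineP_pow L m (n + 1)) x) ≠ v → WL2.equiv ℂ (fun _ : TSite d (towerP L m (n + 1)) => c₀) W w x = 0)
        (_hwF : ∀ x, ‖WL2.equiv ℂ (fun _ : TSite d (towerP L m (n + 1)) => c₀) W w x‖ ≤ F),
        (∀ x : TSite d (towerP L m (n + 1)), ‖WL2.equiv ℂ (fun _ : TSite d (towerP L m (n + 1)) => c₀) W (GpOfUk L m n φ η U a' (c₁ := c₁) hpos' (LinearMap.adjoint ((WL2.linearEquiv ℂ ℂ (fun _ : TSite d m => c₁)).symm.toLinearMap ∘ₗ QprimeTowerW L m n φ U (c₀ := c₀)) (greenK _ (QGGQk_pos_of_unitary L m n φ c₀ η U c₁ a' τ hτ₂ hφτ hUst hpos') (((WL2.linearEquiv ℂ ℂ (fun _ : TSite d m => c₁)).symm.toLinearMap ∘ₗ QprimeTowerW L m n φ U (c₀ := c₀)) (GpOfUk L m n φ η U a' (c₁ := c₁) hpos' w))))) x‖ ≤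
          Bx * Real.exp (-(κx * tdist m (blockCoord (L ^ (n + 1)) m (siteCast (towerP_eq_fineP_pow L m (n + 1)) x)) v)) * F) ∧
        (∀ b : Bond d (towerP L m (n + 1)), ‖WL2.equiv ℂ (fun _ : Bond d (towerP L m (n + 1)) => c₀) W (covDerivL2K ℂ c₀ ((η : ℂ))⁻¹ (adTransportW φ U) (GpOfUk L m n φ η U a' (c₁ := c₁) hpos' (LinearMap.adjoint ((WL2.linearEquiv ℂ ℂ (fun _ : TSite d m => c₁)).symm.toLinearMap ∘ₗ QprimeTowerW L m n φ U (c₀ := c₀)) (greenK _ (QGGQk_pos_of_unitary L m n φ c₀ η U c₁ a' τ hτ₂ hφτ hUst hpos') (((WL2.linearEquiv ℂ ℂ (fun _ : TSite d m => c₁)).symm.toLinearMap ∘ₗ QprimeTowerW L m n φ U (c₀ := c₀)) (GpOfUk L m n φ η U a' (c₁ := c₁) hpos' w)))))) b‖ ≤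
          Bx * Real.exp (-(κx * tdist m (blockCoord (L ^ (n + 1)) m (siteCast (towerP_eq_fineP_pow L m (n + 1)) (bpos b))) v)) * F) := by
  classical
  have hL2 : 2 ≤ L := le_trans (by norm_num) hL3
  obtain ⟨αD, BD, κD, hαD, hBD, hκD, HD⟩ := exists_gradRow_GpOfUk L φ hMφ hMφ' hφ hφ' ha' hϱ0 hϱ1 τ hτ₂ hφτ hd hL2
  obtain ⟨αP, CP, ρP, κP, hαP, hCP, hρP, hκP, _hκPρ, h2κP, HP⟩ := exists_decayRow_GpOfUk L φ hMφ hMφ' hφ hφ' ha' hϱ0 hϱ1 τ hτ₂ hφτ hd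
  obtain ⟨αC, BC, ρC, hαC, hBC, hρC, HC⟩ := exists_local_letter_QGGQInvk_closed hd L hL hL3 φ hMφ hMφ' hφ hφ' ha ha' hϱ0 hϱ1 τ hτ hCτ hρw hτ₁ hτ₂ hφτ hMτ
  -- (DRC)'s constant
  set BP : ℝ := ((1 + |a'| * CP) * (Real.exp (1 / 2) * 2) * (∑ l ∈ Finset.range d, (2 : ℝ) ^ (l + 1)) +
      Real.sqrt (3 ^ d * 2 ^ d) * Real.sqrt ((Real.exp (1 / 2) * 2) * latticeConst d (Real.sqrt (1 / (4 * d + 1)) - 2 * κP)) * CP) with hBP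
  have hBP0 : 0 ≤ BP := by positivity
  -- the common rate and window
  obtain ⟨κ, hκdef⟩ : ∃ κ : ℝ, κ = min κD (min κP ρC) := ⟨_, rfl⟩
  have hκ0 : 0 < κ := by rw [hκdef]; exact lt_min hκD (lt_min hκP hρC)
  have hκD' : κ ≤ κD := by rw [hκdef]; exact min_le_left _ _
  have hκP' : κ ≤ κP := by rw [hκdef]; exact (min_le_right _ _).trans (min_le_left _ _)
  have hκC' : κ ≤ ρC := by rw [hκdef]; exact (min_le_right _ _).trans (min_le_right _ _)
  obtain ⟨αs, hαs⟩ : ∃ αs : ℝ, αs = min αD (min αP αC) := ⟨_, rfl⟩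
  have hαs0 : 0 < αs := by rw [hαs]; exact lt_min hαD (lt_min hαP hαC)
  obtain ⟨K, hKdef⟩ : ∃ K : ℝ, K = latticeConst d (κ - κ / 2) := ⟨_, rfl⟩
  have hK0 : 0 ≤ K := by rw [hKdef]; exact latticeConst_nonneg d (sub_pos.2 (half_lt_self hκ0)).le
  obtain ⟨Bs, hBs⟩ : ∃ Bs : ℝ, Bs = BP * (1 * Real.exp (κ * 0)) * K * BC * K * (1 * Real.exp (κ * 0)) * K * (BP + BD * Real.exp (κ / 2)) * K := ⟨_, rfl⟩
  have hBs0 : 0 ≤ Bs := by rw [hBs]; positivity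
  refine ⟨αs, Bs, κ / 2, hαs0, hBs0, by positivity, ?_⟩
  intro n η hηL c₀ c₁ _ _ hw hρ m _ hm U αU hα0 hα1 hU1 hreg εU hεU hUε hLb α hα hαle hUst hUb hUη hpl hUgrad hRlev hεg hAQ hpos' v w F hwv hwF
  have hc₀ : (0 : ℝ) < c₀ := Fact.out
  obtain ⟨x0⟩ : Nonempty (TSite d (towerP L m (n + 1))) := ⟨fun i => ⟨0, Nat.pos_of_ne_zero (NeZero.ne _)⟩⟩
  haveI : Nonempty (TSite d (towerP L m (n + 1))) := ⟨x0⟩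
  have hc₁ : (0 : ℝ) < c₁ := Fact.out
  haveI : Nonempty (TSite d m) := ⟨v⟩
  have hRS : ∀ (b : Bond d (towerP L m (n + 1))) (v u : W), ⟪adTransportW φ U b v, u⟫_ℂ = ⟪v, adTransportW φ (fun b => (U b)⁻¹) b u⟫_ℂ :=
    adTransportW_adjoint φ τ hτ₂ hUst hφτ
  have hαD_ : α ≤ αD := hαle.trans (by rw [hαs]; exact min_le_left _ _)
  have hαP_ : α ≤ αP := hαle.trans (by rw [hαs]; exact (min_le_right _ _).trans (min_le_left _ _))
  have hαC_ : α ≤ αC := hαle.trans (by rw [hαs]; exact (min_le_right _ _).trans (min_le_right _ _))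
  -- the block families: fine sites by their big block, coarse sites by themselves
  obtain ⟨PS, hPS⟩ := exists_block_clm_family (𝕜 := ℂ) (w := fun _ : TSite d (towerP L m (n + 1)) => c₀) (V := W)
    (fun x : TSite d (towerP L m (n + 1)) => blockCoord (L ^ (n + 1)) m (siteCast (towerP_eq_fineP_pow L m (n + 1)) x))
  obtain ⟨rY, hrY⟩ := exists_block_clm_family (𝕜 := ℂ) (w := fun _ : TSite d m => c₁) (V := W) (id : TSite d m → TSite d m)
  -- the letters `Q̃′_k`, `Q̃′_k†`, `c`, `G′_k`, `D_UG′_k` as linear maps, then as CLMs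
  obtain ⟨Qt, hQt⟩ : ∃ Qt : SiteL2K ℂ d (towerP L m (n + 1)) c₀ W →ₗ[ℂ] SiteL2K ℂ d m c₁ W,
      Qt = (WL2.linearEquiv ℂ ℂ (fun _ : TSite d m => c₁)).symm.toLinearMap ∘ₗ QprimeTowerW L m n φ U (c₀ := c₀) := ⟨_, rfl⟩
  obtain ⟨c, hc⟩ : ∃ c : SiteL2K ℂ d m c₁ W →ₗ[ℂ] SiteL2K ℂ d m c₁ W, c = greenK _ (QGGQk_pos_of_unitary L m n φ c₀ η U c₁ a' τ hτ₂ hφτ hUst hpos') := ⟨_, rfl⟩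
  obtain ⟨GPcl, hGPcl⟩ : ∃ T : SiteL2K ℂ d (towerP L m (n + 1)) c₀ W →L[ℂ] SiteL2K ℂ d (towerP L m (n + 1)) c₀ W,
      T = LinearMap.toContinuousLinearMap (GpOfUk L m n φ η U a' (c₁ := c₁) hpos') := ⟨_, rfl⟩
  obtain ⟨Qcl, hQcl⟩ : ∃ T : SiteL2K ℂ d (towerP L m (n + 1)) c₀ W →L[ℂ] SiteL2K ℂ d m c₁ W, T = LinearMap.toContinuousLinearMap Qt := ⟨_, rfl⟩
  obtain ⟨Qacl, hQacl⟩ : ∃ T : SiteL2K ℂ d m c₁ W →L[ℂ] SiteL2K ℂ d (towerP L m (n + 1)) c₀ W,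
      T = LinearMap.toContinuousLinearMap (LinearMap.adjoint Qt) := ⟨_, rfl⟩
  obtain ⟨DGcl, hDGcl⟩ : ∃ T : SiteL2K ℂ d (towerP L m (n + 1)) c₀ W →L[ℂ] BondL2K ℂ d (towerP L m (n + 1)) c₀ W,
      T = LinearMap.toContinuousLinearMap (covDerivL2K ℂ c₀ ((η : ℂ))⁻¹ (adTransportW φ U) ∘ₗ GpOfUk L m n φ η U a' (c₁ := c₁) hpos') := ⟨_, rfl⟩
  obtain ⟨Ccl, hCcl⟩ : ∃ T : SiteL2K ℂ d m c₁ W →L[ℂ] SiteL2K ℂ d m c₁ W, T = LinearMap.toContinuousLinearMap c := ⟨_, rfl⟩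
  -- (L)(G′_k) at rate κ
  have hGp : ∀ (v : TSite d m) (f : SiteL2K ℂ d (towerP L m (n + 1)) c₀ W) (F : ℝ),
      (∀ x, blockCoord (L ^ (n + 1)) m (siteCast (towerP_eq_fineP_pow L m (n + 1)) x) ≠ v →
        WL2.equiv ℂ (fun _ : TSite d (towerP L m (n + 1)) => c₀) W f x = 0) →
      (∀ x, ‖WL2.equiv ℂ (fun _ : TSite d (towerP L m (n + 1)) => c₀) W f x‖ ≤ F) →
      ∀ x, ‖WL2.equiv ℂ (fun _ : TSite d (towerP L m (n + 1)) => c₀) W (GPcl f) x‖ ≤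
        BP * Real.exp (-(κ * tdist m (blockCoord (L ^ (n + 1)) m (siteCast (towerP_eq_fineP_pow L m (n + 1)) x)) v)) * F := by
    intro v f F hfv hfF x
    have hF : 0 ≤ F := (norm_nonneg _).trans (hfF x)
    have h := HP n η hηL c₀ c₁ hw m U hRS α hα hαP_ hUb hUη εU hεU hεg hUε hLb hUst hRlev hpos' PS hPS v x f F hfv hfF
    rw [hGPcl, LinearMap.coe_toContinuousLinearMap']
    calc _ ≤ BP * Real.exp (-(κP * tdist m (blockCoord (L ^ (n + 1)) m (siteCast (towerP_eq_fineP_pow L m (n + 1)) x)) v)) * F := h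
      _ ≤ _ := mul_le_mul_of_nonneg_right (mul_le_mul_of_nonneg_left (exp_weaken' hκP' (tdist_nonneg m _ _)) hBP0) hF
  -- the FORWARD averaging `Q̃′_k`: value at `y` reads the fibre of `y` only; size `sup` on the diagonal
  have eQ : ∀ (f : SiteL2K ℂ d (towerP L m (n + 1)) c₀ W) (y : TSite d m),
      WL2.equiv ℂ (fun _ : TSite d m => c₁) W (Qcl f) y = QprimeTowerW L m n φ U (c₀ := c₀) f y := by
    intro f y
    rw [hQcl, LinearMap.coe_toContinuousLinearMap', hQt]
    rfl
  have hμS : ∀ y : TSite d m, ∑ x : TSite d (towerP L m (n + 1)),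
      (if blockCoord (L ^ (n + 1)) m (siteCast (towerP_eq_fineP_pow L m (n + 1)) x) = y then c₀ else 0) ≤ c₁ := by
    intro y
    rw [← Finset.sum_filter, Finset.sum_const, nsmul_eq_mul, ← hw]
    have h := card_sites_bigBlock_le L m (n + 1) y
    have h' : ((Finset.univ.filter (fun x : TSite d (towerP L m (n + 1)) =>
        blockCoord (L ^ (n + 1)) m (siteCast (towerP_eq_fineP_pow L m (n + 1)) x) = y)).card : ℝ) ≤ ((L : ℝ) ^ (n + 1)) ^ d := by
      exact_mod_cast h
    rw [mul_comm]
    exact mul_le_mul_of_nonneg_left h' hc₀.le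
  have hQM : ∀ (f : SiteL2K ℂ d (towerP L m (n + 1)) c₀ W) (F : ℝ),
      (∀ x, ‖WL2.equiv ℂ (fun _ : TSite d (towerP L m (n + 1)) => c₀) W f x‖ ≤ F) →
      ∀ y, ‖WL2.equiv ℂ (fun _ : TSite d m => c₁) W (Qcl f) y‖ ≤ 1 * F := by
    intro f F hfF y
    have hF : 0 ≤ F := (norm_nonneg _).trans (hfF x0)
    -- restrict to the fibre of `y`
    have hloc : WL2.equiv ℂ (fun _ : TSite d m => c₁) W (Qcl f) y = WL2.equiv ℂ (fun _ : TSite d m => c₁) W (Qcl (PS y f)) y := by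
      rw [eQ, eQ]
      refine QprimeTowerW_apply_eq_of_eqOn_fibre L m n φ U f (PS y f) y (fun x hx => ?_)
      rw [hPS, if_pos ((bigBlock_eq_iff L m n x y).2 hx)]
    rw [hloc]
    -- the restricted field: block-supported, sup ≤ F, hence `‖·‖_{c₀} ≤ √c₁·F`
    have hn : ‖PS y f‖ ≤ Real.sqrt c₁ * F :=
      norm_le_sqrt_mass_mul (w := fun _ : TSite d (towerP L m (n + 1)) => c₀)
        (π := fun x : TSite d (towerP L m (n + 1)) => blockCoord (L ^ (n + 1)) m (siteCast (towerP_eq_fineP_pow L m (n + 1)) x))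
        y (hμS y) (PS y f) hF (fun x hx => by rw [hPS, if_neg hx]) (fun x => by
          rw [hPS]
          by_cases hx : blockCoord (L ^ (n + 1)) m (siteCast (towerP_eq_fineP_pow L m (n + 1)) x) = y
          · rw [if_pos hx]; exact hfF x
          · rw [if_neg hx, norm_zero]; exact hF)
    -- the `L²` letter of `Q̃′_k` (= `1` on the diagonal) and one term of the `c₁`-weighted norm
    have h2 := norm_QtildeTower_le L m n φ (c₀ := c₀) (c₁ := c₁) U hRlev (PS y f)
    have hdiag : Real.sqrt (c₁ / (c₀ * ((L : ℝ) ^ (n + 1)) ^ d)) = 1 := by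
      rw [← hw, div_self (ne_of_gt (by positivity)), Real.sqrt_one]
    rw [hdiag, one_mul] at h2
    have h1 := WL2.weight_mul_norm_sq_apply_le (𝕜 := ℂ) (w := fun _ : TSite d m => c₁) (Qcl (PS y f)) y
    have hQn : ‖Qcl (PS y f)‖ ≤ Real.sqrt c₁ * F := by
      rw [hQcl, LinearMap.coe_toContinuousLinearMap', hQt]
      exact h2.trans hn
    have hsq : c₁ * ‖WL2.equiv ℂ (fun _ : TSite d m => c₁) W (Qcl (PS y f)) y‖ ^ 2 ≤ (Real.sqrt c₁ * F) ^ 2 :=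
      h1.trans (pow_le_pow_left₀ (norm_nonneg _) hQn 2)
    rw [mul_pow, Real.sq_sqrt hc₁.le] at hsq
    have hsq' : ‖WL2.equiv ℂ (fun _ : TSite d m => c₁) W (Qcl (PS y f)) y‖ ^ 2 ≤ F ^ 2 := le_of_mul_le_mul_left (by linarith) hc₁
    rw [one_mul]
    exact (pow_le_pow_iff_left₀ (norm_nonneg _) hF two_ne_zero).1 hsq'
  have hQρ : ∀ (v : TSite d m) (f : SiteL2K ℂ d (towerP L m (n + 1)) c₀ W),
      (∀ x, blockCoord (L ^ (n + 1)) m (siteCast (towerP_eq_fineP_pow L m (n + 1)) x) ≠ v →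
        WL2.equiv ℂ (fun _ : TSite d (towerP L m (n + 1)) => c₀) W f x = 0) →
      ∀ y, (0 : ℝ) < tdist m (id y) v → WL2.equiv ℂ (fun _ : TSite d m => c₁) W (Qcl f) y = 0 := by
    intro v f hfv y hy
    have hyv : y ≠ v := by
      intro hyv
      have h0 : tdist m (id y) v = 0 := by rw [show id y = y from rfl, hyv, tdist_self]
      rw [h0] at hy
      exact lt_irrefl _ hy
    have hloc : WL2.equiv ℂ (fun _ : TSite d m => c₁) W (Qcl f) y = WL2.equiv ℂ (fun _ : TSite d m => c₁) W (Qcl 0) y := by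
      rw [eQ, eQ]
      refine QprimeTowerW_apply_eq_of_eqOn_fibre L m n φ U f 0 y (fun x hx => ?_)
      have hxy : blockCoord (L ^ (n + 1)) m (siteCast (towerP_eq_fineP_pow L m (n + 1)) x) = y := (bigBlock_eq_iff L m n x y).2 hx
      rw [hfv x (by rw [hxy]; exact hyv), WL2.equiv_zero, Pi.zero_apply]
    rw [hloc, map_zero, WL2.equiv_zero, Pi.zero_apply]
  have hQ := letter_of_range (tdist m)
    (fun x : TSite d (towerP L m (n + 1)) => blockCoord (L ^ (n + 1)) m (siteCast (towerP_eq_fineP_pow L m (n + 1)) x))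
    (id : TSite d m → TSite d m) Qcl (M := 1) (ρ := 0) (κ := κ) hκ0.le hQM hQρ
  -- the ADJOINT averaging `Q̃′_k†`: value at `x` reads `g(Πx)` only; size `‖g‖_∞` on the diagonal ((K64) §2's two steps)
  have hQaM : ∀ (g : SiteL2K ℂ d m c₁ W) (Gs : ℝ), (∀ u, ‖WL2.equiv ℂ (fun _ : TSite d m => c₁) W g u‖ ≤ Gs) →
      ∀ x, ‖WL2.equiv ℂ (fun _ : TSite d (towerP L m (n + 1)) => c₀) W (Qacl g) x‖ ≤ 1 * Gs := by
    intro g Gs hgG x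
    have hG0 : 0 ≤ Gs := (norm_nonneg _).trans (hgG v)
    obtain ⟨z₀, hz₀⟩ : ∃ z₀ : TSite d m, z₀ = blockCoord (L ^ (n + 1)) m (siteCast (towerP_eq_fineP_pow L m (n + 1)) x) := ⟨_, rfl⟩
    -- restrict `g` to the one coarse point `Πx`
    have hloc : WL2.equiv ℂ (fun _ : TSite d (towerP L m (n + 1)) => c₀) W (Qacl g) x =
        WL2.equiv ℂ (fun _ : TSite d (towerP L m (n + 1)) => c₀) W (Qacl (rY z₀ g)) x := by
      rw [hQacl, LinearMap.coe_toContinuousLinearMap', hQt]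
      exact adjoint_QtildeTower_apply_eq_of_eq_at L m n φ (c₀ := c₀) U g (rY z₀ g) x (fun z hz => by
        have hz' : blockCoord (L ^ (n + 1)) m (siteCast (towerP_eq_fineP_pow L m (n + 1)) x) = z := (bigBlock_eq_iff L m n x z).2 hz
        rw [hrY, if_pos (show id z = z₀ from hz'.symm.trans hz₀.symm)])
    rw [hloc]
    have hμ : ∑ y : TSite d m, (if id y = z₀ then c₁ else 0) ≤ c₁ := by
      show ∑ y : TSite d m, (if y = z₀ then c₁ else 0) ≤ c₁
      rw [Finset.sum_ite_eq' Finset.univ z₀ (fun _ => c₁), if_pos (Finset.mem_univ _)]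
    have hgn : ‖rY z₀ g‖ ≤ Real.sqrt c₁ * Gs :=
      norm_le_sqrt_mass_mul (π := id) (w := fun _ : TSite d m => c₁) z₀ hμ (rY z₀ g) hG0 (fun y hy => by rw [hrY, if_neg hy])
        (fun y => by
          rw [hrY]
          by_cases hy : id y = z₀
          · rw [if_pos hy]; exact hgG y
          · rw [if_neg hy, norm_zero]; exact hG0)
    have e := norm_adjoint_QtildeTower_apply_le L m n φ (c₀ := c₀) U hRlev (rY z₀ g) x
    rw [hQacl, LinearMap.coe_toContinuousLinearMap', hQt]
    refine e.trans ?_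
    have hLp : (0 : ℝ) < ((L : ℝ) ^ (n + 1)) ^ d := by positivity
    calc Real.sqrt c₁ * (((L : ℝ) ^ (n + 1)) ^ d)⁻¹ / c₀ * ‖rY z₀ g‖
        ≤ Real.sqrt c₁ * (((L : ℝ) ^ (n + 1)) ^ d)⁻¹ / c₀ * (Real.sqrt c₁ * Gs) := by gcongr
      _ = c₁ / (c₀ * ((L : ℝ) ^ (n + 1)) ^ d) * Gs := by
          rw [show Real.sqrt c₁ * (((L : ℝ) ^ (n + 1)) ^ d)⁻¹ / c₀ * (Real.sqrt c₁ * Gs) =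
            Real.sqrt c₁ * Real.sqrt c₁ * ((((L : ℝ) ^ (n + 1)) ^ d)⁻¹ / c₀) * Gs by ring, Real.mul_self_sqrt hc₁.le]
          field_simp
      _ = 1 * Gs := by rw [← hw, div_self (ne_of_gt (by positivity)), one_mul]
  have hQaρ : ∀ (v : TSite d m) (g : SiteL2K ℂ d m c₁ W), (∀ u, id u ≠ v → WL2.equiv ℂ (fun _ : TSite d m => c₁) W g u = 0) →
      ∀ x, (0 : ℝ) < tdist m (blockCoord (L ^ (n + 1)) m (siteCast (towerP_eq_fineP_pow L m (n + 1)) x)) v →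
        WL2.equiv ℂ (fun _ : TSite d (towerP L m (n + 1)) => c₀) W (Qacl g) x = 0 := by
    intro v g hgv x hx
    have hxv : blockCoord (L ^ (n + 1)) m (siteCast (towerP_eq_fineP_pow L m (n + 1)) x) ≠ v := by
      intro hxv
      have h0 : tdist m (blockCoord (L ^ (n + 1)) m (siteCast (towerP_eq_fineP_pow L m (n + 1)) x)) v = 0 := by rw [hxv, tdist_self]
      rw [h0] at hx
      exact lt_irrefl _ hx
    have e := adjoint_QtildeTower_apply_eq_of_eq_at L m n φ (c₀ := c₀) U g 0 x (fun z hz => by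
      have hz' : blockCoord (L ^ (n + 1)) m (siteCast (towerP_eq_fineP_pow L m (n + 1)) x) = z := (bigBlock_eq_iff L m n x z).2 hz
      have hzv : z ≠ v := fun hzv => hxv (hz'.trans hzv)
      rw [hgv z hzv, WL2.equiv_zero, Pi.zero_apply])
    rw [hQacl, LinearMap.coe_toContinuousLinearMap', hQt, e, map_zero, WL2.equiv_zero, Pi.zero_apply]
  have hQa := letter_of_range (tdist m) (id : TSite d m → TSite d m)
    (fun x : TSite d (towerP L m (n + 1)) => blockCoord (L ^ (n + 1)) m (siteCast (towerP_eq_fineP_pow L m (n + 1)) x)) Qacl (M := 1) (ρ := 0) (κ := κ) hκ0.le hQaM hQaρ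
  -- (L)(D_UG′_k) from (GRC), output at the bond's TIP block, weakened to `κ`
  have hDG : ∀ (v : TSite d m) (f : SiteL2K ℂ d (towerP L m (n + 1)) c₀ W) (F : ℝ),
      (∀ x, blockCoord (L ^ (n + 1)) m (siteCast (towerP_eq_fineP_pow L m (n + 1)) x) ≠ v →
        WL2.equiv ℂ (fun _ : TSite d (towerP L m (n + 1)) => c₀) W f x = 0) →
      (∀ x, ‖WL2.equiv ℂ (fun _ : TSite d (towerP L m (n + 1)) => c₀) W f x‖ ≤ F) →
      ∀ x, ‖WL2.equiv ℂ (fun _ : Bond d (towerP L m (n + 1)) => c₀) W (DGcl f) x‖ ≤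
        BD * Real.exp (-(κ * tdist m (blockCoord (L ^ (n + 1)) m (siteCast (towerP_eq_fineP_pow L m (n + 1)) (btgt x))) v)) * F := by
    intro v f F hfv hfF x
    have hF : 0 ≤ F := (norm_nonneg _).trans (hfF x0)
    have h := HD n η hηL c₀ c₁ hw m U hRS α hα hαD_ hUb hUη hUgrad εU hεU hεg hUε hLb hUst hRlev hpos' PS hPS v f F hF hfv hfF x
    rw [hDGcl, LinearMap.coe_toContinuousLinearMap']
    calc _ ≤ BD * F * Real.exp (-(κD * tdist m (blockCoord (L ^ (n + 1)) m (siteCast (towerP_eq_fineP_pow L m (n + 1)) (btgt x))) v)) := h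
      _ ≤ BD * F * Real.exp (-(κ * tdist m (blockCoord (L ^ (n + 1)) m (siteCast (towerP_eq_fineP_pow L m (n + 1)) (btgt x))) v)) :=
          mul_le_mul_of_nonneg_left (exp_weaken' hκD' (tdist_nonneg m _ _)) (mul_nonneg hBD hF)
      _ = _ := by ring
  have hCk : ∀ (v : TSite d m) (g : SiteL2K ℂ d m c₁ W) (F : ℝ), (∀ u, id u ≠ v → WL2.equiv ℂ (fun _ : TSite d m => c₁) W g u = 0) →
      (∀ u, ‖WL2.equiv ℂ (fun _ : TSite d m => c₁) W g u‖ ≤ F) →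
      ∀ u, ‖WL2.equiv ℂ (fun _ : TSite d m => c₁) W (Ccl g) u‖ ≤ BC * Real.exp (-(κ * tdist m (id u) v)) * F := by
    intro v g F hgv hgF u
    have hF : 0 ≤ F := (norm_nonneg _).trans (hgF v)
    have h := HC n η hηL c₀ c₁ hw hρ m hm U αU hα1 hU1 hreg εU hεU hUε hLb α hα hαC_
      hUst hUb hUη hpl hεg hpos' rY hrY v g F (fun y hy => hgv y hy) hgF u
    rw [hCcl, LinearMap.coe_toContinuousLinearMap', hc]
    exact h.trans (mul_le_mul_of_nonneg_right (mul_le_mul_of_nonneg_left (exp_weaken' hκC' (tdist_nonneg m _ _)) hBC) hF)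
  -- the four compositions on the coarse torus (rate lost once)
  have hgap : 0 < κ - κ / 2 := sub_pos.2 (half_lt_self hκ0)
  have hκh0 : (0 : ℝ) ≤ κ / 2 := (half_pos hκ0).le
  have hκh : κ / 2 ≤ κ := half_le_self hκ0.le
  have he0 : (0 : ℝ) ≤ 1 * Real.exp (κ * 0) := mul_nonneg zero_le_one (Real.exp_nonneg _)
  have hB2 : (0 : ℝ) ≤ BP * (1 * Real.exp (κ * 0)) * K := mul_nonneg (mul_nonneg hBP0 he0) hK0
  have hB3 : (0 : ℝ) ≤ BP * (1 * Real.exp (κ * 0)) * K * BC * K := mul_nonneg (mul_nonneg hB2 hBC) hK0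
  have hB4 : (0 : ℝ) ≤ BP * (1 * Real.exp (κ * 0)) * K * BC * K * (1 * Real.exp (κ * 0)) * K := mul_nonneg (mul_nonneg hB3 he0) hK0
  have hS : ∀ w' : TSite d m, ∑ u : TSite d m, Real.exp (-((κ - κ / 2) * tdist m w' u)) ≤ K := fun w' => by
    rw [hKdef]; exact torusSum_le d hm hgap w'
  -- `Q̃′_k ∘ G′_k`
  have h₂ := letter_comp (tdist m)
    (fun x : TSite d (towerP L m (n + 1)) => blockCoord (L ^ (n + 1)) m (siteCast (towerP_eq_fineP_pow L m (n + 1)) x))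
    (fun x : TSite d (towerP L m (n + 1)) => blockCoord (L ^ (n + 1)) m (siteCast (towerP_eq_fineP_pow L m (n + 1)) x))
    (id : TSite d m → TSite d m) GPcl Qcl (tdist_nonneg m) (fun u y w' => tdist_triangle hm u y w')
    (B₁ := BP) (B₂ := 1 * Real.exp (κ * 0)) (κ₁ := κ) (κ₂ := κ) (κ' := κ / 2) (S := K) hBP0 he0 hκh0 hκh hGp hQ hS
  -- `c ∘ Q̃′_k ∘ G′_k`
  have h₃ := letter_comp (tdist m)
    (fun x : TSite d (towerP L m (n + 1)) => blockCoord (L ^ (n + 1)) m (siteCast (towerP_eq_fineP_pow L m (n + 1)) x))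
    (id : TSite d m → TSite d m) (id : TSite d m → TSite d m) (Qcl ∘L GPcl) Ccl (tdist_nonneg m) (fun u y w' => tdist_triangle hm u y w')
    (B₁ := BP * (1 * Real.exp (κ * 0)) * K) (B₂ := BC) (κ₁ := κ / 2) (κ₂ := κ) (κ' := κ / 2) (S := K) hB2 hBC hκh0 le_rfl h₂ hCk hS
  -- `Q̃′_k† ∘ c ∘ Q̃′_k ∘ G′_k`
  have h₄ := letter_comp (tdist m)
    (fun x : TSite d (towerP L m (n + 1)) => blockCoord (L ^ (n + 1)) m (siteCast (towerP_eq_fineP_pow L m (n + 1)) x))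
    (id : TSite d m → TSite d m)
    (fun x : TSite d (towerP L m (n + 1)) => blockCoord (L ^ (n + 1)) m (siteCast (towerP_eq_fineP_pow L m (n + 1)) x))
    (Ccl ∘L (Qcl ∘L GPcl)) Qacl (tdist_nonneg m) (fun u y w' => tdist_triangle hm u y w')
    (B₁ := BP * (1 * Real.exp (κ * 0)) * K * BC * K) (B₂ := 1 * Real.exp (κ * 0)) (κ₁ := κ / 2) (κ₂ := κ) (κ' := κ / 2) (S := K)
    hB3 he0 hκh0 le_rfl h₃ hQa hS
  -- value: `G′_k ∘ Q̃′_k† ∘ c ∘ Q̃′_k ∘ G′_k`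
  have h₅ := letter_comp (tdist m)
    (fun x : TSite d (towerP L m (n + 1)) => blockCoord (L ^ (n + 1)) m (siteCast (towerP_eq_fineP_pow L m (n + 1)) x))
    (fun x : TSite d (towerP L m (n + 1)) => blockCoord (L ^ (n + 1)) m (siteCast (towerP_eq_fineP_pow L m (n + 1)) x))
    (fun x : TSite d (towerP L m (n + 1)) => blockCoord (L ^ (n + 1)) m (siteCast (towerP_eq_fineP_pow L m (n + 1)) x))
    (Qacl ∘L (Ccl ∘L (Qcl ∘L GPcl))) GPcl (tdist_nonneg m) (fun u y w' => tdist_triangle hm u y w')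
    (B₁ := BP * (1 * Real.exp (κ * 0)) * K * BC * K * (1 * Real.exp (κ * 0)) * K) (B₂ := BP) (κ₁ := κ / 2) (κ₂ := κ) (κ' := κ / 2)
    (S := K) hB4 hBP0 hκh0 le_rfl h₄ hGp hS v w F hwv hwF
  -- gradient: `D_UG′_k ∘ Q̃′_k† ∘ c ∘ Q̃′_k ∘ G′_k` (tip block, then re-blocked to the base)
  have h₆ := letter_comp (tdist m)
    (fun x : TSite d (towerP L m (n + 1)) => blockCoord (L ^ (n + 1)) m (siteCast (towerP_eq_fineP_pow L m (n + 1)) x))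
    (fun x : TSite d (towerP L m (n + 1)) => blockCoord (L ^ (n + 1)) m (siteCast (towerP_eq_fineP_pow L m (n + 1)) x))
    (fun x : Bond d (towerP L m (n + 1)) => blockCoord (L ^ (n + 1)) m (siteCast (towerP_eq_fineP_pow L m (n + 1)) (btgt x)))
    (Qacl ∘L (Ccl ∘L (Qcl ∘L GPcl))) DGcl (tdist_nonneg m) (fun u y w' => tdist_triangle hm u y w')
    (B₁ := BP * (1 * Real.exp (κ * 0)) * K * BC * K * (1 * Real.exp (κ * 0)) * K) (B₂ := BD) (κ₁ := κ / 2) (κ₂ := κ) (κ' := κ / 2)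
    (S := K) hB4 hBD hκh0 le_rfl h₄ hDG hS v w F hwv hwF
  -- the word unfolded
  have eX : GpOfUk L m n φ η U a' (c₁ := c₁) hpos' (LinearMap.adjoint ((WL2.linearEquiv ℂ ℂ (fun _ : TSite d m => c₁)).symm.toLinearMap ∘ₗ QprimeTowerW L m n φ U (c₀ := c₀)) (greenK _ (QGGQk_pos_of_unitary L m n φ c₀ η U c₁ a' τ hτ₂ hφτ hUst hpos') (((WL2.linearEquiv ℂ ℂ (fun _ : TSite d m => c₁)).symm.toLinearMap ∘ₗ QprimeTowerW L m n φ U (c₀ := c₀)) (GpOfUk L m n φ η U a' (c₁ := c₁) hpos' w)))) = (GPcl ∘L (Qacl ∘L (Ccl ∘L (Qcl ∘L GPcl)))) w := by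
    simp only [hGPcl, hQacl, hCcl, hQcl, hc, hQt, ContinuousLinearMap.comp_apply, LinearMap.coe_toContinuousLinearMap', LinearMap.comp_apply]
  have eDX : covDerivL2K ℂ c₀ ((η : ℂ))⁻¹ (adTransportW φ U) (GpOfUk L m n φ η U a' (c₁ := c₁) hpos' (LinearMap.adjoint ((WL2.linearEquiv ℂ ℂ (fun _ : TSite d m => c₁)).symm.toLinearMap ∘ₗ QprimeTowerW L m n φ U (c₀ := c₀)) (greenK _ (QGGQk_pos_of_unitary L m n φ c₀ η U c₁ a' τ hτ₂ hφτ hUst hpos') (((WL2.linearEquiv ℂ ℂ (fun _ : TSite d m => c₁)).symm.toLinearMap ∘ₗ QprimeTowerW L m n φ U (c₀ := c₀)) (GpOfUk L m n φ η U a' (c₁ := c₁) hpos' w))))) = (DGcl ∘L (Qacl ∘L (Ccl ∘L (Qcl ∘L GPcl)))) w := by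
    simp only [hDGcl, hGPcl, hQacl, hCcl, hQcl, hc, hQt, ContinuousLinearMap.comp_apply, LinearMap.coe_toContinuousLinearMap', LinearMap.comp_apply]
  have hF0 : 0 ≤ F := (norm_nonneg _).trans (hwF x0)
  have hBP_le : BP ≤ BP + BD * Real.exp (κ / 2) := by nlinarith [Real.exp_pos (κ / 2)]
  have hBD_le : BD * Real.exp (κ / 2) ≤ BP + BD * Real.exp (κ / 2) := by linarith
  refine ⟨fun x => ?_, fun b => ?_⟩
  · rw [eX]
    refine (h₅ x).trans ?_
    have hE : 0 ≤ Real.exp (-(κ / 2 * tdist m (blockCoord (L ^ (n + 1)) m (siteCast (towerP_eq_fineP_pow L m (n + 1)) x)) v)) * F := mul_nonneg (Real.exp_nonneg _) hF0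
    calc _ = (BP * (1 * Real.exp (κ * 0)) * K * BC * K * (1 * Real.exp (κ * 0)) * K * BP * K) * (Real.exp (-(κ / 2 * tdist m (blockCoord (L ^ (n + 1)) m (siteCast (towerP_eq_fineP_pow L m (n + 1)) x)) v)) * F) := by ring
      _ ≤ (BP * (1 * Real.exp (κ * 0)) * K * BC * K * (1 * Real.exp (κ * 0)) * K * (BP + BD * Real.exp (κ / 2)) * K) *
          (Real.exp (-(κ / 2 * tdist m (blockCoord (L ^ (n + 1)) m (siteCast (towerP_eq_fineP_pow L m (n + 1)) x)) v)) * F) :=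
          mul_le_mul_of_nonneg_right (mul_le_mul_of_nonneg_right (mul_le_mul_of_nonneg_left hBP_le hB4) hK0) hE
      _ = Bs * Real.exp (-(κ / 2 * tdist m (blockCoord (L ^ (n + 1)) m (siteCast (towerP_eq_fineP_pow L m (n + 1)) x)) v)) * F := by rw [hBs]; ring
  · rw [eDX]
    refine (h₆ b).trans ?_
    -- tip block → base block
    have htri : tdist m (blockCoord (L ^ (n + 1)) m (siteCast (towerP_eq_fineP_pow L m (n + 1)) (bpos b))) v ≤ tdist m (blockCoord (L ^ (n + 1)) m (siteCast (towerP_eq_fineP_pow L m (n + 1)) (btgt b))) v + 1 := by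
      have h1 := tdist_triangle hm (blockCoord (L ^ (n + 1)) m (siteCast (towerP_eq_fineP_pow L m (n + 1)) (bpos b))) (blockCoord (L ^ (n + 1)) m (siteCast (towerP_eq_fineP_pow L m (n + 1)) (btgt b))) v
      have h2 := tdist_bigBlock_bpos_btgt_le_one L m (n + 1) hm b
      linarith only [h1, h2]
    have hre : Real.exp (-(κ / 2 * tdist m (blockCoord (L ^ (n + 1)) m (siteCast (towerP_eq_fineP_pow L m (n + 1)) (btgt b))) v)) ≤
        Real.exp (κ / 2) * Real.exp (-(κ / 2 * tdist m (blockCoord (L ^ (n + 1)) m (siteCast (towerP_eq_fineP_pow L m (n + 1)) (bpos b))) v)) := by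
      rw [← Real.exp_add]; exact Real.exp_le_exp.2 (by nlinarith [mul_le_mul_of_nonneg_left htri hκh0])
    have hE : 0 ≤ Real.exp (-(κ / 2 * tdist m (blockCoord (L ^ (n + 1)) m (siteCast (towerP_eq_fineP_pow L m (n + 1)) (bpos b))) v)) * F := mul_nonneg (Real.exp_nonneg _) hF0
    calc _ ≤ (BP * (1 * Real.exp (κ * 0)) * K * BC * K * (1 * Real.exp (κ * 0)) * K) * BD * K *
          (Real.exp (κ / 2) * Real.exp (-(κ / 2 * tdist m (blockCoord (L ^ (n + 1)) m (siteCast (towerP_eq_fineP_pow L m (n + 1)) (bpos b))) v))) * F :=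
          mul_le_mul_of_nonneg_right (mul_le_mul_of_nonneg_left hre (mul_nonneg (mul_nonneg hB4 hBD) hK0)) hF0
      _ = (BP * (1 * Real.exp (κ * 0)) * K * BC * K * (1 * Real.exp (κ * 0)) * K * (BD * Real.exp (κ / 2)) * K) *
          (Real.exp (-(κ / 2 * tdist m (blockCoord (L ^ (n + 1)) m (siteCast (towerP_eq_fineP_pow L m (n + 1)) (bpos b))) v)) * F) := by ring
      _ ≤ (BP * (1 * Real.exp (κ * 0)) * K * BC * K * (1 * Real.exp (κ * 0)) * K * (BP + BD * Real.exp (κ / 2)) * K) *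
          (Real.exp (-(κ / 2 * tdist m (blockCoord (L ^ (n + 1)) m (siteCast (towerP_eq_fineP_pow L m (n + 1)) (bpos b))) v)) * F) :=
          mul_le_mul_of_nonneg_right (mul_le_mul_of_nonneg_right (mul_le_mul_of_nonneg_left hBD_le hB4) hK0) hE
      _ = Bs * Real.exp (-(κ / 2 * tdist m (blockCoord (L ^ (n + 1)) m (siteCast (towerP_eq_fineP_pow L m (n + 1)) (bpos b))) v)) * F := by rw [hBs]; ring

end Literature.MathematicalPhysics.QuantumFieldTheory.Balaban1983to89.B9Eq3152RkWordSupGradLettersClosed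

end
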